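import Summits.CriticalPhenomena.PercolationContinuityZ3.Theorems.PercNearOneGluingNoHeavyLowerTailFirstHitChargingStar
import Literature.Probability.LatticeModels.ProdBernoulliIndependence
import HarnessLib

/-!
# Crux `PercNearOneGluing.NoHeavyLowerTail` (stmt-CriticalPhenomena-4575), line `comonotone-deadzone` —
# the stub S2 (comonotone dead-zone domination) HOLDS FOR STAR-ATTACHED OBSERVERS (depth one)

Prover `prover-rtask-CriticalPhenomena-PercNearOneG-529c20ca-0` (strategy (a), domination), 2026-08-17.
Lands with `--supports stmt-CriticalPhenomena-4575 --as helper`.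

Notation: `μ = prodBernoulli w` on bond configurations of the complete graph on `Fin n`; relay set `A ∋ b`,
observer `o ∉ A` attached ONLY to relay points (every pair `s(o, v)` with `v ∉ A` has weight `0`);
`q a = w s(o,a)`, `u(v) = μ(v ↮ b)`.

* `comonotoneDeadZone_star` — for such star-attached observers the registered stub of the line holds:
  `μ(o ↔ A, o ↮ b) ≤ ∫₀¹ μ(o ↔ A inside {v | t ≤ u(v)} ∪ {o}) dt`.

Proof.  The landed first-hit charging bound (`firstHitChargingStar`, Kozma–Nitzan Thm 4 / Lemma 3(ii) in
charging form) gives `μ(o ↔ A, o ↮ b) ≤ Σ_a π_a u(a)` with `π_a = q_a ∏_{a' beats a} (1 − q_{a'})`, the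
probability of the event `F_a` = "the finger to `a` is open and the fingers to every relay beating `a` are
closed" (`beats` = deader off `o`, ties by index — a strict total order on `A`, so the `F_a` are pairwise
disjoint).  Write `u(a) = ∫₀¹ 1{t ≤ u(a)} dt` and exchange sum and integral: for every threshold `t`,
`Σ_{a : t ≤ u(a)} π_a = μ(⋃_{a : t ≤ u(a)} F_a) ≤ μ(some finger into A ∩ {u ≥ t} is open) ≤
μ(o ↔ A inside {u ≥ t} ∪ {o})` (an open finger `o — a` with `u(a) ≥ t` is an open path inside the level
set).  Integrating over `t ∈ (0,1)` gives the claim.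
-/

namespace Summit.CriticalPhenomena.PercolationContinuityZ3.Theorems

open MeasureTheory Set Literature.Probability.LatticeModels Literature.Probability.Percolation
open scoped Classical BigOperators

section ComonotoneDeadZoneStar

variable {n : ℕ}

/-- All fingers `o — a'`, `a' ∈ B`, closed: probability `∏_{a' ∈ B} (1 − w s(o,a'))`. [folklore] -/
theorem cdzStar_real_fingersClosed (w : Sym2 (Fin n) → unitInterval) (o : Fin n) (B : Finset (Fin n)) :
    (prodBernoulli w).real {ω : BondConfig (Fin n) | ∀ a' ∈ B, s(o, a') ∉ ω} =
      ∏ a' ∈ B, (1 - ((w s(o, a') : unitInterval) : ℝ)) := by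
  have hset : {ω : BondConfig (Fin n) | ∀ a' ∈ B, s(o, a') ∉ ω} =
      {ω : Set (Sym2 (Fin n)) | ∀ e ∈ B.image (fun a' => s(o, a')), e ∉ ω} := by
    ext ω
    simp only [Set.mem_setOf_eq, Finset.forall_mem_image]
  have hinj : Set.InjOn (fun a' : Fin n => s(o, a')) ↑B := by
    intro x _ y _ hxy
    exact Sym2.congr_right.1 hxy
  rw [hset, prodBernoulli_real_forall_notMem, Finset.prod_image hinj]

/-- The first-hit event `F_a` = {finger to `a` open, fingers to `B` closed} (`a ∉ B`) has probability
`w s(o,a) · ∏_{a' ∈ B} (1 − w s(o,a'))`. [folklore] -/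
theorem cdzStar_real_firstHit (w : Sym2 (Fin n) → unitInterval) (o a : Fin n) (B : Finset (Fin n))
    (haB : a ∉ B) :
    (prodBernoulli w).real {ω : BondConfig (Fin n) | s(o, a) ∈ ω ∧ ∀ a' ∈ B, s(o, a') ∉ ω} =
      ((w s(o, a) : unitInterval) : ℝ) * ∏ a' ∈ B, (1 - ((w s(o, a') : unitInterval) : ℝ)) := by
  set μ := prodBernoulli w with hμ
  have hdiff : {ω : BondConfig (Fin n) | s(o, a) ∈ ω ∧ ∀ a' ∈ B, s(o, a') ∉ ω} =
      {ω : BondConfig (Fin n) | ∀ a' ∈ B, s(o, a') ∉ ω} \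
        {ω : BondConfig (Fin n) | ∀ a' ∈ insert a B, s(o, a') ∉ ω} := by
    ext ω
    simp only [Set.mem_setOf_eq, Set.mem_sdiff, Finset.forall_mem_insert, not_and]
    constructor
    · rintro ⟨ha, hB⟩; exact ⟨hB, fun hna _ => hna ha⟩
    · rintro ⟨hB, h⟩
      refine ⟨?_, hB⟩
      by_contra hna
      exact h hna hB
  have hsub : {ω : BondConfig (Fin n) | ∀ a' ∈ insert a B, s(o, a') ∉ ω} ⊆
      {ω : BondConfig (Fin n) | ∀ a' ∈ B, s(o, a') ∉ ω} :=
    fun ω hω a' ha' => hω a' (Finset.mem_insert_of_mem ha')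
  rw [hdiff, measureReal_sdiff hsub MeasurableSet.of_discrete, cdzStar_real_fingersClosed,
    cdzStar_real_fingersClosed, Finset.prod_insert haB]
  ring

/-- `∫₀¹ c · 1{t ≤ u} dt = c · u` for `u ∈ [0, 1]` (written with `Set.indicator`). [folklore] -/
theorem cdzStar_integral_indicator (c u : ℝ) (hu0 : 0 ≤ u) (hu1 : u ≤ 1) :
    ∫ t in (0 : ℝ)..1, (Set.Iic u).indicator (fun _ => c) t = c * u := by
  have hint : ∀ x y : ℝ, IntervalIntegrable ((Set.Iic u).indicator fun _ : ℝ => c) volume x y := by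
    intro x y
    by_cases hc : 0 ≤ c
    · refine (Antitone.antitoneOn ?_ _).intervalIntegrable
      intro s t hst
      by_cases ht : t ∈ Set.Iic u
      · have hs : s ∈ Set.Iic u := le_trans hst ht
        simp [Set.indicator_of_mem, hs, ht]
      · rw [Set.indicator_of_notMem ht]
        by_cases hs : s ∈ Set.Iic u
        · rw [Set.indicator_of_mem hs]; exact hc
        · rw [Set.indicator_of_notMem hs]
    · push Not at hc
      refine (Monotone.monotoneOn ?_ _).intervalIntegrable
      intro s t hst
      by_cases ht : t ∈ Set.Iic u
      · have hs : s ∈ Set.Iic u := le_trans hst ht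
        simp [Set.indicator_of_mem, hs, ht]
      · rw [Set.indicator_of_notMem ht]
        by_cases hs : s ∈ Set.Iic u
        · rw [Set.indicator_of_mem hs]; exact hc.le
        · rw [Set.indicator_of_notMem hs]
  rw [← intervalIntegral.integral_add_adjacent_intervals (hint 0 u) (hint u 1)]
  have h1 : ∫ t in (0 : ℝ)..u, (Set.Iic u).indicator (fun _ => c) t = c * u := by
    have hae : ∀ᵐ t ∂(volume : Measure ℝ), t ∈ Set.uIoc 0 u →
        (Set.Iic u).indicator (fun _ : ℝ => c) t = (fun _ => c) t := by
      refine Filter.Eventually.of_forall fun t ht => ?_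
      rw [Set.uIoc_of_le hu0] at ht
      exact Set.indicator_of_mem (show t ∈ Set.Iic u from ht.2) _
    rw [intervalIntegral.integral_congr_ae hae, intervalIntegral.integral_const, smul_eq_mul]
    ring
  have h2 : ∫ t in u..1, (Set.Iic u).indicator (fun _ => c) t = 0 := by
    have hae : ∀ᵐ t ∂(volume : Measure ℝ), t ∈ Set.uIoc u 1 →
        (Set.Iic u).indicator (fun _ : ℝ => c) t = (fun _ => (0 : ℝ)) t := by
      refine Filter.Eventually.of_forall fun t ht => ?_
      rw [Set.uIoc_of_le hu1] at ht
      exact Set.indicator_of_notMem (show t ∉ Set.Iic u from not_le.2 ht.1) _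
    rw [intervalIntegral.integral_congr_ae hae]
    simp
  rw [h1, h2, add_zero]

/-- **S2 holds for star-attached observers.**  If `b ∈ A`, `o ∉ A` and `o` is attached only to relay
points (`w s(o,v) = 0` for `v ∉ A`, `v ≠ o`), then
`μ(o ↔ A, o ↮ b) ≤ ∫₀¹ μ(o ↔ A inside {v | t ≤ μ(v ↮ b)} ∪ {o}) dt` — the registered stub
`stub_comonotoneDeadZone` of the line `comonotone-deadzone`, in the depth-one class.  Input: the landed
first-hit charging bound `firstHitChargingStar` (Kozma–Nitzan arXiv:2401.12397 Thm 4 / Lemma 3(ii)).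
[folklore] -/
theorem comonotoneDeadZone_star (w : Sym2 (Fin n) → unitInterval) (A : Finset (Fin n)) (o b : Fin n)
    (hbA : b ∈ A) (hoA : o ∉ A) (hw0 : ∀ v : Fin n, v ∉ A → v ≠ o → w s(o, v) = 0) :
    (prodBernoulli w).real ((⋃ a ∈ A, openConn o a) ∩ (openConn o b)ᶜ) ≤
      ∫ t in (0 : ℝ)..1, (prodBernoulli w).real
        (⋃ a ∈ A, openConnIn ({v : Fin n | t ≤ (prodBernoulli w).real (openConn v b)ᶜ} ∪ {o}) o a) := by
  set μ := prodBernoulli w with hμ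
  -- notation: deadness off `o`, the `beats` filter, fingers, budgets, first-hit weights and events
  set d : Fin n → ℝ := fun x => μ.real (openConnIn (({o} : Set (Fin n))ᶜ) x b)ᶜ with hd
  set Bt : Fin n → Finset (Fin n) := fun a => A.filter (fun a' => d a < d a' ∨ (d a = d a' ∧ a < a'))
    with hBt
  set q : Fin n → ℝ := fun a => ((w s(o, a) : unitInterval) : ℝ) with hq
  set u : Fin n → ℝ := fun x => μ.real (openConn x b)ᶜ with hu
  set π : Fin n → ℝ := fun a => q a * ∏ a' ∈ Bt a, (1 - q a') with hπ
  set F : Fin n → Set (BondConfig (Fin n)) :=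
    fun a => {ω | s(o, a) ∈ ω ∧ ∀ a' ∈ Bt a, s(o, a') ∉ ω} with hF
  set f : ℝ → ℝ := fun t => μ.real
    (⋃ a ∈ A, openConnIn ({v : Fin n | t ≤ μ.real (openConn v b)ᶜ} ∪ {o}) o a) with hf
  -- Step 0: the landed charging bound
  have h0 : μ.real ((⋃ a ∈ A, openConn o a) ∩ (openConn o b)ᶜ) ≤ ∑ a ∈ A, π a * u a :=
    firstHitChargingStar n w A o b hbA hoA hw0
  -- basic facts
  have hu0 : ∀ x, 0 ≤ u x := fun x => measureReal_nonneg
  have hu1 : ∀ x, u x ≤ 1 := fun x => measureReal_le_one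
  have hq0 : ∀ a, 0 ≤ q a := fun a => (w s(o, a)).2.1
  have hq1 : ∀ a, q a ≤ 1 := fun a => (w s(o, a)).2.2
  have hπ0 : ∀ a, 0 ≤ π a := fun a =>
    mul_nonneg (hq0 a) (Finset.prod_nonneg fun a' _ => sub_nonneg.2 (hq1 a'))
  have haBt : ∀ a, a ∉ Bt a := by
    intro a ha
    rcases (Finset.mem_filter.1 ha).2 with h | ⟨_, h⟩
    · exact lt_irrefl _ h
    · exact lt_irrefl _ h
  have hπF : ∀ a, μ.real (F a) = π a := fun a => cdzStar_real_firstHit w o a (Bt a) (haBt a)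
  -- Step 1: the first-hit events are pairwise disjoint
  have hdisj : ∀ a₁ ∈ A, ∀ a₂ ∈ A, a₁ ≠ a₂ → Disjoint (F a₁) (F a₂) := by
    intro a₁ ha₁ a₂ ha₂ hne
    -- one of them beats the other
    have hbeats : a₂ ∈ Bt a₁ ∨ a₁ ∈ Bt a₂ := by
      rcases lt_trichotomy (d a₁) (d a₂) with h | h | h
      · exact Or.inl (Finset.mem_filter.2 ⟨ha₂, Or.inl h⟩)
      · rcases lt_or_gt_of_ne hne with h' | h'
        · exact Or.inl (Finset.mem_filter.2 ⟨ha₂, Or.inr ⟨h, h'⟩⟩)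
        · exact Or.inr (Finset.mem_filter.2 ⟨ha₁, Or.inr ⟨h.symm, h'⟩⟩)
      · exact Or.inr (Finset.mem_filter.2 ⟨ha₁, Or.inl h⟩)
    rw [Set.disjoint_left]
    rintro ω ⟨h₁, h₁'⟩ ⟨h₂, h₂'⟩
    rcases hbeats with h | h
    · exact h₁' a₂ h h₂
    · exact h₂' a₁ h h₁
  -- Step 2: for every threshold, the charged mass below the level profile
  have hstep : ∀ t : ℝ, ∑ a ∈ A, (Set.Iic (u a)).indicator (fun _ => π a) t ≤ f t := by
    intro t
    set At : Finset (Fin n) := A.filter (fun a => t ≤ u a) with hAt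
    have hsum : ∑ a ∈ A, (Set.Iic (u a)).indicator (fun _ => π a) t = ∑ a ∈ At, μ.real (F a) := by
      rw [hAt, Finset.sum_filter]
      refine Finset.sum_congr rfl fun a _ => ?_
      by_cases hta : t ≤ u a
      · rw [if_pos hta, Set.indicator_of_mem (show t ∈ Set.Iic (u a) from hta), hπF]
      · rw [if_neg hta, Set.indicator_of_notMem (show t ∉ Set.Iic (u a) from hta)]
    have hunion : ∑ a ∈ At, μ.real (F a) = μ.real (⋃ a ∈ At, F a) := by
      rw [measureReal_biUnion_finset]
      · intro a₁ ha₁ a₂ ha₂ hne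
        exact hdisj a₁ (Finset.mem_filter.1 ha₁).1 a₂ (Finset.mem_filter.1 ha₂).1 hne
      · exact fun _ _ => MeasurableSet.of_discrete
    have hincl : (⋃ a ∈ At, F a) ⊆
        ⋃ a ∈ A, openConnIn ({v : Fin n | t ≤ μ.real (openConn v b)ᶜ} ∪ {o}) o a := by
      intro ω hω
      rw [Set.mem_iUnion₂] at hω ⊢
      obtain ⟨a, haAt, hopen, -⟩ := hω
      obtain ⟨haA, hta⟩ := Finset.mem_filter.1 haAt
      have hao : a ≠ o := fun h => hoA (h ▸ haA)
      have hoS : o ∈ ({v : Fin n | t ≤ μ.real (openConn v b)ᶜ} ∪ {o}) := Or.inr rfl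
      have haS : a ∈ ({v : Fin n | t ≤ μ.real (openConn v b)ᶜ} ∪ {o}) := Or.inl hta
      refine ⟨a, haA, hoS, haS, SimpleGraph.Adj.reachable ?_⟩
      simp only [SimpleGraph.comap_adj, Function.Embedding.coe_subtype, openGraph_adj]
      exact ⟨hopen, hao.symm⟩
    rw [hsum, hunion]
    exact measureReal_mono hincl (measure_ne_top _ _)
  -- Step 3: integrate
  have hint_ind : ∀ a, ∀ x y : ℝ,
      IntervalIntegrable ((Set.Iic (u a)).indicator fun _ : ℝ => π a) volume x y := by
    intro a x y
    refine (Antitone.antitoneOn ?_ _).intervalIntegrable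
    intro s s' hss'
    by_cases hs' : s' ∈ Set.Iic (u a)
    · have hs : s ∈ Set.Iic (u a) := le_trans hss' hs'
      simp [Set.indicator_of_mem, hs, hs']
    · rw [Set.indicator_of_notMem hs']
      by_cases hs : s ∈ Set.Iic (u a)
      · rw [Set.indicator_of_mem hs]; exact hπ0 a
      · rw [Set.indicator_of_notMem hs]
  have hint_sum : ∀ x y : ℝ, IntervalIntegrable
      (fun t => ∑ a ∈ A, (Set.Iic (u a)).indicator (fun _ : ℝ => π a) t) volume x y := by
    intro x y
    have h := IntervalIntegrable.sum A fun a _ => hint_ind a x y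
    have hfun : (fun t => ∑ a ∈ A, (Set.Iic (u a)).indicator (fun _ : ℝ => π a) t) =
        ∑ a ∈ A, (Set.Iic (u a)).indicator (fun _ : ℝ => π a) := by
      funext t
      simp only [Finset.sum_apply]
    rw [hfun]
    exact h
  have hf_anti : Antitone f := by
    intro s t hst
    have hsub : ({v : Fin n | t ≤ μ.real (openConn v b)ᶜ} ∪ {o}) ⊆
        ({v : Fin n | s ≤ μ.real (openConn v b)ᶜ} ∪ {o}) :=
      Set.union_subset_union_left _ fun v (hv : t ≤ _) => le_trans hst hv
    refine measureReal_mono (Set.iUnion₂_mono fun a _ => ?_) (measure_ne_top _ _)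
    rintro ω ⟨hx, hy, hr⟩
    exact ⟨hsub hx, hsub hy, hr.map (SimpleGraph.induceHomOfLE (G := openGraph ω) hsub).toHom⟩
  have hint_f : ∀ x y : ℝ, IntervalIntegrable f volume x y :=
    fun x y => (hf_anti.antitoneOn _).intervalIntegrable
  have hlhs : ∑ a ∈ A, π a * u a =
      ∫ t in (0 : ℝ)..1, ∑ a ∈ A, (Set.Iic (u a)).indicator (fun _ => π a) t := by
    rw [intervalIntegral.integral_finsetSum fun a _ => hint_ind a 0 1]
    exact Finset.sum_congr rfl fun a _ => (cdzStar_integral_indicator (π a) (u a) (hu0 a) (hu1 a)).symm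
  calc μ.real ((⋃ a ∈ A, openConn o a) ∩ (openConn o b)ᶜ)
      ≤ ∑ a ∈ A, π a * u a := h0
    _ = ∫ t in (0 : ℝ)..1, ∑ a ∈ A, (Set.Iic (u a)).indicator (fun _ => π a) t := hlhs
    _ ≤ ∫ t in (0 : ℝ)..1, f t :=
        intervalIntegral.integral_mono_on zero_le_one (hint_sum 0 1) (hint_f 0 1) fun t _ => hstep t

end ComonotoneDeadZoneStar

end Summit.CriticalPhenomena.PercolationContinuityZ3.Theorems
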